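import Mathlib
import HarnessLib

/-!
# Route OrthantWake — objects posited by the prover's TWIN-EMBEDDING argument
(definitions file, D-0016: definitions are reviewed, never buried in a proof file; serves the items
stmt-NavierStokesRegularity-26438 `OrthantWake.ForwardHopWake`, -26608
`SubOnsagerCeiling.ForwardTailCeiling`, -26373 `SubcriticalEnvelope.ForwardSourceTailEnvelope`)

The three "forward-source" cruxes of the TL-M2Break cluster quantify `∃ S : Finset (Fin 4)` with the
SYNTACTIC source condition `i ∉ S → α i j l (0,0,1) = 0` over ALL (orthant) tables of `E₂(R)`. The
objects below show that this syntactic observable can be forced to be the TOTAL tail energy on a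
table whose dynamics is that of a dead-end table already refuted numerically:

* `twinSideBranchTable` — the side-branch dead-end table `α_SB`
  (`SubOnsagerCeiling.sideBranchTable`, the lead's numerical witness against `OrthantTailCeiling`)
  with its pocket feed `x_{1,k}² → x_{2,k+1}` (`1/5`) split into twin feeds (`3/25` into component
  `2`, `4/25` into component `3`) plus the rank-one DIFFERENTIAL FEED `(4x_{2,k} − 3x_{3,k})²/16 →
  x_{0,k+1}` with the symmetric back-reaction split. Orthant tables are MORE than Katz–Pavlović
  networks: the finite criterion `orthant_iff_coefficients` allows feed forms with negative cross
  entries (here `α_{230,(0,0,1)} = −3/4`), and such a feed conserves `3x_2 + 4x_3`, so balanced twin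
  pockets are parked forever although both twins are syntactic sources. (Sibling files:
  `E₂(17)`, orthant, all-source; exact solution embedding.)
* `twinMix`, `twinEmbed` — the linear map `(X_0, X_1, X_2, X_3) ↦ (X_0, X_1, (3/5)X_2, (4/5)X_2)`
  on vectors / lattice trajectories, which sends `α_SB` solutions to `twin-α_SB` solutions with the
  same shell energies.
(The construction hypothesis `ThinResidueStatesSB` of the conditional refutation of
`ForwardHopWake` lives with that negative lemma, as the tree's `ThinResidueStates` does.)

HONEST FRAMING: MODEL-lattice objects in Tao's §4 vocabulary (rung TL-M2Break); nothing here is a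
statement about the Navier–Stokes equations; no crux is proved or refuted by this file.
References for the vocabulary: [cite: Tao2016AveragedNS, §4 (4.2)–(4.3), (4.8)]; Katz–Pavlović /
dyadic positivity: [cite: BarbatoMorandinRomito2011, §2].
-/

noncomputable section

-- the sub-problem namespace `NavierStokesRegularity.NavierStokesRegularity` is the tree's layout (D-0017)
set_option linter.dupNamespace false

namespace Summit.NavierStokesRegularity.NavierStokesRegularity.Theorems

/-- THE TWIN SIDE-BRANCH TABLE `twin-α_SB` (prover ns-ow-p1 g4): the side-branch dead-end table
`α_SB = SubOnsagerCeiling.sideBranchTable` (chain `x_{0,k}² → x_{0,k+1}` with coefficient `1`, in-shell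
pump `x_{0,k}² → x_{1,k}` with `1/5`) whose dead-end feed `x_{1,k}² → x_{2,k+1}` (`1/5`) is SPLIT into
twin feeds `x_{1,k}² → x_{2,k+1}` (`3/25`) and `x_{1,k}² → x_{3,k+1}` (`4/25`), plus the rank-one
DIFFERENTIAL FEED `(4x_{2,k} − 3x_{3,k})²/16 → x_{0,k+1}` with the symmetric back-reaction split
(`α_{203,(0,1,0)} = α_{302,(0,1,0)} = 3/8`), which conserves `3x_2 + 4x_3`. Every component is a
syntactic forward source (`α_{i i ·,(0,0,1)} ≠ 0` for all `i`), the table is symmetric, cancelling,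
`17`-comparable and orthant, and `(X_0, X_1, (3/5)X_2, (4/5)X_2)` solves its lattice whenever `X`
solves the `α_SB` lattice (sibling files). MODEL-lattice object (Tao 2016 §4 vocabulary); nothing
here concerns the Navier–Stokes equations. [this file; routes OrthantWake / SubOnsagerCeiling /
SubcriticalEnvelope] -/
def twinSideBranchTable : Fin 4 → Fin 4 → Fin 4 → ℤ × ℤ × ℤ → ℝ := fun i₁ i₂ i₃ μ =>
  if μ = ((0 : ℤ), (0 : ℤ), (1 : ℤ)) then
    ((if i₁ = 0 ∧ i₂ = 0 ∧ i₃ = 0 then (1 : ℝ) else 0) +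
      (if i₁ = 1 ∧ i₂ = 1 ∧ i₃ = 2 then 3 / 25 else 0) +
      (if i₁ = 1 ∧ i₂ = 1 ∧ i₃ = 3 then 4 / 25 else 0) +
      (if i₁ = 2 ∧ i₂ = 2 ∧ i₃ = 0 then 1 else 0) +
      (if i₁ = 3 ∧ i₂ = 3 ∧ i₃ = 0 then 9 / 16 else 0) +
      (if ((i₁ = 2 ∧ i₂ = 3) ∨ (i₁ = 3 ∧ i₂ = 2)) ∧ i₃ = 0 then -(3 / 4) else 0))
  else if μ = ((1 : ℤ), (0 : ℤ), (0 : ℤ)) then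
    ((if i₁ = 0 ∧ i₂ = 0 ∧ i₃ = 0 then (-(1 / 2) : ℝ) else 0) +
      (if i₁ = 2 ∧ i₂ = 1 ∧ i₃ = 1 then -(3 / 50) else 0) +
      (if i₁ = 3 ∧ i₂ = 1 ∧ i₃ = 1 then -(2 / 25) else 0) +
      (if i₁ = 0 ∧ i₂ = 2 ∧ i₃ = 2 then -(1 / 2) else 0) +
      (if i₁ = 0 ∧ i₂ = 3 ∧ i₃ = 3 then -(9 / 32) else 0) +
      (if i₁ = 0 ∧ i₂ = 2 ∧ i₃ = 3 then 3 / 8 else 0) +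
      (if i₁ = 0 ∧ i₂ = 3 ∧ i₃ = 2 then 3 / 8 else 0))
  else if μ = ((0 : ℤ), (1 : ℤ), (0 : ℤ)) then
    ((if i₁ = 0 ∧ i₂ = 0 ∧ i₃ = 0 then (-(1 / 2) : ℝ) else 0) +
      (if i₁ = 1 ∧ i₂ = 2 ∧ i₃ = 1 then -(3 / 50) else 0) +
      (if i₁ = 1 ∧ i₂ = 3 ∧ i₃ = 1 then -(2 / 25) else 0) +
      (if i₁ = 2 ∧ i₂ = 0 ∧ i₃ = 2 then -(1 / 2) else 0) +
      (if i₁ = 3 ∧ i₂ = 0 ∧ i₃ = 3 then -(9 / 32) else 0) +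
      (if i₁ = 2 ∧ i₂ = 0 ∧ i₃ = 3 then 3 / 8 else 0) +
      (if i₁ = 3 ∧ i₂ = 0 ∧ i₃ = 2 then 3 / 8 else 0))
  else if μ = ((0 : ℤ), (0 : ℤ), (0 : ℤ)) then
    ((if i₁ = 0 ∧ i₂ = 0 ∧ i₃ = 1 then (1 / 5 : ℝ) else 0) +
      (if ((i₁ = 0 ∧ i₂ = 1) ∨ (i₁ = 1 ∧ i₂ = 0)) ∧ i₃ = 0 then -(1 / 10) else 0))
  else 0

/-- THE TWIN MIXING of a four-component vector: `(v_0, v_1, v_2, v_3) ↦ (v_0, v_1, (3/5)v_2, (4/5)v_2)`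
(component `3` of the input is dropped; `(3/5)² + (4/5)² = 1` preserves the energy of component `2`,
and `4·(3/5) = 3·(4/5)` balances the differential feed of `twinSideBranchTable`). [this file] -/
def twinMix (v : Fin 4 → ℝ) : Fin 4 → ℝ := fun i =>
  if i = 0 then v 0 else if i = 1 then v 1 else if i = 2 then 3 / 5 * v 2 else 4 / 5 * v 2

/-- THE TWIN EMBEDDING of lattice trajectories: `twinMix` applied componentwise at every shell and
time, `(X_0, X_1, X_2, X_3) ↦ (X_0, X_1, (3/5)X_2, (4/5)X_2)`. It maps solutions of the `α_SB` lattice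
to solutions of the `twinSideBranchTable` lattice with the same shell energies (sibling file). [this file] -/
def twinEmbed (X : Fin 4 → ℤ → ℝ → ℝ) : Fin 4 → ℤ → ℝ → ℝ := fun i k t => twinMix (fun j => X j k t) i

end Summit.NavierStokesRegularity.NavierStokesRegularity.Theorems

end
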